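import Literature.NumberTheory.Rogawski1990.ArchimedeanTransfer          -- ★ `ArchSmooth` (the test class `C_c^∞(U(H)(L ⊗ ℝ))` by restriction), ★ `IsArchSmooth`, ★ `archGroupGL`
import Literature.NumberTheory.Automorphic.UnitaryGroupFormTransport     -- ★ `GLn.conjEquiv` (conjugation as a homeomorphic automorphism of `GL_N`)
import Mathlib.Analysis.Normed.Algebra.MatrixExponential
import HarnessLib

/-!
# The archimedean congruence transport, TEST-FUNCTION half: `ArchSmooth` is invariant under `a ↦ a ∘ Φ⁻¹` for `Φ : U(H₂)(L ⊗ ℝ) ≃ₜ* U(H)(L ⊗ ℝ)`, `g ↦ T g T⁻¹`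
(ROAD-Sd (T-d), FILE 4 = memo item (d); Rogawski 1990 §14.2 p. 233 «`f′_∞ ∈ C_c^∞(G′_∞)`», §14.4 p. 237 «`f_v = f′_v ∘ ψ_v⁻¹`»; Borel–Jacquet 1979 §1.1, §4.1)

Topic `NumberTheory/Rogawski1990`; namespaces `Literature.NumberTheory.Automorphic` (§1, the ambient `GL_N(L ⊗ ℝ)` statement) and `Literature.NumberTheory.Rogawski1990` (§2).  THEOREMS ONLY
(no `def`, no instance, no notation, no axiom, no named fact, no `sorry`).  Cell `pub/hodgecm-mathlib`, ENGINE T1 (crux H413 = `stmt-HodgeConjecture-24833`); floor-1 preparation, count-neutral,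
under books rows #88 (ST-∞) ∕ #111 (S-d): ROAD-Sd item (T-d) «CONGRUENCE TRANSPORT» (LEAD DESK WORDS T8-39 ∕ T8-42, F0P3a-plan (g9), 2026-09-01; memo of record F0P3a-p06 (g9)
`ROAD-Sd-3prime-congruence` item (d) «`ArchSmooth L 3 H″ a″ → ArchSmooth L 3 H′ (a″ ∘ φ⁻¹)`»; census `CENSUS-Td-CongruenceTransport.F0P3a-p02g10.md` 9b2b941dccae668a FILE 2 §5); author
F0P3a-p02 (g10).  Sequel of ★ FILE 1 `Automorphic/ArchCongruenceOrbitalTransport`, ★ FILE 2 `ArchInnerTransferCongruence`, FILE 3 `KottwitzSignArchCongruence`; independent of them.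

WHY.  The closer's archimedean letters quantify over test functions `a ∈ C_c^∞(U(H)(L ⊗ ℝ))` in the tree's currency ★ `ArchSmooth L N H a`: `a` is the restriction of a continuous, compactly
supported `φ : GL_N(L ⊗ ℝ) → ℂ` which is SMOOTH UNDER RIGHT TRANSLATIONS (★ `IsArchSmooth (archGroupGL N L).carrier.subtype φ`: `X ↦ φ(g · exp X)` is `C^∞` on `𝔤𝔩_N(L ⊗ ℝ)` for every
`g`) [BorelJacquet1979 §1.1, §4.1].  Transporting a pair `(a′, a)` of the inner-transfer relation along a congruence `Φ : U(H₂) ≃ₜ* U(H)`, `g ↦ T g T⁻¹` replaces `a` by `a ∘ Φ⁻¹`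
(«`f_v = f′_v ∘ ψ_v⁻¹`» [Rogawski1990 §14.4 p. 237]) — the restriction of `φ^T : y ↦ φ(T⁻¹ y T)`; and `φ^T` is again right-translation smooth because
`φ^T(g · exp X) = φ((T⁻¹gT) · exp(T⁻¹XT))` (Mathlib `Matrix.exp_units_conj'`) with `X ↦ T⁻¹XT` linear, continuous with the compact support carried by the homeomorphism `y ↦ T⁻¹yT`.

WHAT IS PROVED.
* §1 (ambient, any number field `L`, any `N`, any `T ∈ GL_N(L ⊗ ℝ)`): `expGL_units_conj` (`exp(T⁻¹XT) = T⁻¹·exp X·T` in `GL_N`), **`IsArchSmooth.comp_units_conj`** (`φ` right-translation smooth ⇒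
  so is `y ↦ φ(T⁻¹ y T)`), `Continuous.comp_units_conj`, `HasCompactSupport.comp_units_conj`.
* §2 **`ArchSmooth.comp_archCongr_symm`**: for `Φ : U(H₂)(L ⊗ ℝ) ≃ₜ* U(H)(L ⊗ ℝ)` with `hΦ : ↑(Φ g) = T·↑g·T⁻¹`, `ArchSmooth L N H₂ a → ArchSmooth L N H (a ∘ Φ⁻¹)`; `archSmooth_comp_archCongr_symm_iff`
  (`↔`, the converse along `Φ⁻¹` acting by `T⁻¹`); `ArchSmooth.comp_archCongr` (`ArchSmooth L N H a → ArchSmooth L N H₂ (a ∘ Φ)`).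
HONEST LABEL: HC_CM is proved only modulo the printed citations until rung 0 closes; this file is bookkeeping and pays nothing by itself.

## References
* [Rogawski1990] J. D. Rogawski, *Automorphic Representations of Unitary Groups in Three Variables*, Ann. of Math. Stud. 123 (1990), §14.2 p. 233, §14.4 p. 237.
* [BorelJacquet1979] A. Borel, H. Jacquet, *Automorphic forms and automorphic representations*, PSPM 33.1 (1979), §1.1, §4.1 (smooth = `C^∞` under right translations by `G_∞`).
* [Knapp2002] A. W. Knapp, *Lie Groups Beyond an Introduction*, 2nd ed. (2002), I §10 (1.83) (`Ad(g) exp X = exp(Ad(g) X)`).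
-/

set_option autoImplicit false

noncomputable section

open MeasureTheory NumberField NumberField.InfinitePlace NumberField.mixedEmbedding Topology
-- `Classical` is needed to see the Mathlib normed-space instances on `mixedSpace L` (note H5 of ★ `AdelicGLnGlue`)
open scoped Matrix MatrixGroups Matrix.Norms.Operator ContDiff Classical

/-! ## §1 Right-translation smoothness on `GL_N(L ⊗ ℝ)` is preserved by `φ ↦ φ ∘ Ad(T⁻¹)` -/

namespace Literature.NumberTheory.Automorphic

section Ambient

variable {L : Type} [Field L] [NumberField L] {N : ℕ} (T : GL (Fin N) (mixedSpace L))

/-- `exp(T⁻¹ X T) = T⁻¹ · exp X · T` in `GL_N(L ⊗ ℝ)` (Mathlib `Matrix.exp_units_conj'` on units). [cite: Knapp2002, I §10 (1.83)] -/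
theorem expGL_units_conj (X : Matrix (Fin N) (Fin N) (mixedSpace L)) :
    expGL (((T⁻¹ : GL (Fin N) (mixedSpace L)) : Matrix (Fin N) (Fin N) (mixedSpace L)) * X * (T : Matrix (Fin N) (Fin N) (mixedSpace L))) =
      T⁻¹ * expGL X * T := by
  apply Units.ext
  rw [coe_expGL, Units.val_mul, Units.val_mul, coe_expGL]
  exact Matrix.exp_units_conj' T X

/-- **RIGHT-TRANSLATION SMOOTHNESS IS PRESERVED BY `φ ↦ (y ↦ φ(T⁻¹ y T))`**: `φ(T⁻¹ (g·exp X) T) = φ((T⁻¹gT) · exp(T⁻¹XT))` and `X ↦ T⁻¹XT` is a continuous linear self-map of `𝔤𝔩_N(L ⊗ ℝ)`.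
[cite: BorelJacquet1979, §1.1, §4.1] [cite: Knapp2002, I §10 (1.83)] -/
theorem IsArchSmooth.comp_units_conj {φ : GL (Fin N) (mixedSpace L) → ℂ} (hφ : IsArchSmooth (archGroupGL N L).carrier.subtype φ) :
    IsArchSmooth (archGroupGL N L).carrier.subtype fun y : GL (Fin N) (mixedSpace L) => φ (T⁻¹ * y * T) := by
  intro g
  -- Mathlib idiom (Mathlib/Algebra/Lie/OfAssociative.lean), needed to mention the Lie algebra `𝔤𝔩_N = ⊤` of ★ `archGroupGL` (★ `ArchCharactersRealReduction` pattern; no attribute)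
  letI : LieRing (Matrix (Fin N) (Fin N) (mixedSpace L)) := LieRing.ofAssociativeRing
  -- `X ↦ T⁻¹ X T` on the Lie algebra `⊤`
  let Lm : (archGroupGL N L).lie.toSubmodule →ₗ[ℝ] (archGroupGL N L).lie.toSubmodule :=
    { toFun := fun X => ⟨((T⁻¹ : GL (Fin N) (mixedSpace L)) : Matrix (Fin N) (Fin N) (mixedSpace L)) * (X : Matrix (Fin N) (Fin N) (mixedSpace L)) *
          (T : Matrix (Fin N) (Fin N) (mixedSpace L)), by simp [archGroupGL_lie]⟩
      map_add' := fun X Y => by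
        ext1
        simp only [Submodule.coe_add, Matrix.mul_add, Matrix.add_mul]
      map_smul' := fun c X => by
        ext1
        simp only [Submodule.coe_smul, RingHom.id_apply, Matrix.mul_smul, Matrix.smul_mul] }
  haveI : FiniteDimensional ℝ (Matrix (Fin N) (Fin N) (mixedSpace L)) := Module.Finite.matrix
  haveI : FiniteDimensional ℝ (archGroupGL N L).lie.toSubmodule := inferInstance
  have hLsmooth : ContDiff ℝ ∞ (Lm : (archGroupGL N L).lie.toSubmodule → (archGroupGL N L).lie.toSubmodule) :=
    (⟨Lm, Lm.continuous_of_finiteDimensional⟩ : (archGroupGL N L).lie.toSubmodule →L[ℝ] (archGroupGL N L).lie.toSubmodule).contDiff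
  have heq : (fun X : (archGroupGL N L).lie.toSubmodule =>
      (fun y : GL (Fin N) (mixedSpace L) => φ (T⁻¹ * y * T)) (g * (archGroupGL N L).carrier.subtype ((archGroupGL N L).expMem ⟨X, X.2⟩))) =
      (fun Y : (archGroupGL N L).lie.toSubmodule => φ ((T⁻¹ * g * T) * (archGroupGL N L).carrier.subtype ((archGroupGL N L).expMem ⟨Y, Y.2⟩))) ∘
        (Lm : _ → _) := by
    funext X
    simp only [Function.comp_apply, Subgroup.coe_subtype, RealMatrixGroup.coe_expMem]
    congr 1
    change T⁻¹ * (g * expGL (X : Matrix (Fin N) (Fin N) (mixedSpace L))) * T =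
      T⁻¹ * g * T * expGL (((T⁻¹ : GL (Fin N) (mixedSpace L)) : Matrix (Fin N) (Fin N) (mixedSpace L)) *
        (X : Matrix (Fin N) (Fin N) (mixedSpace L)) * (T : Matrix (Fin N) (Fin N) (mixedSpace L)))
    rw [expGL_units_conj]
    group
  rw [heq]
  exact (hφ (T⁻¹ * g * T)).comp hLsmooth

omit [NumberField L] in
/-- Continuity is preserved by `φ ↦ (y ↦ φ(T⁻¹ y T))`. [cite: BorelJacquet1979, §4.1] -/
theorem Continuous.comp_units_conj {φ : GL (Fin N) (mixedSpace L) → ℂ} (hφ : Continuous φ) :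
    Continuous fun y : GL (Fin N) (mixedSpace L) => φ (T⁻¹ * y * T) :=
  hφ.comp ((continuous_const.mul continuous_id).mul continuous_const)

omit [NumberField L] in
/-- Compact support is preserved by `φ ↦ (y ↦ φ(T⁻¹ y T))` (pull-back along the homeomorphism `GLn.conjEquiv T⁻¹`). [cite: BorelJacquet1979, §4.1] -/
theorem HasCompactSupport.comp_units_conj {φ : GL (Fin N) (mixedSpace L) → ℂ} (hφ : HasCompactSupport φ) :
    HasCompactSupport fun y : GL (Fin N) (mixedSpace L) => φ (T⁻¹ * y * T) := by
  have heq : (fun y : GL (Fin N) (mixedSpace L) => φ (T⁻¹ * y * T)) = φ ∘ (GLn.conjEquiv T⁻¹).toHomeomorph := by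
    funext y
    simp only [Function.comp_apply]
    show φ (T⁻¹ * y * T) = φ (GLn.conjEquiv T⁻¹ y)
    rw [GLn.conjEquiv_apply, inv_inv]
  rw [heq]
  exact hφ.comp_homeomorph _

end Ambient

end Literature.NumberTheory.Automorphic

/-! ## §2 `ArchSmooth` under the congruence isomorphism -/

namespace Literature.NumberTheory.Rogawski1990

open Literature.NumberTheory.Automorphic

section Arch

variable (L : Type) [Field L] [NumberField L] [IsCMField L] {N : ℕ} {H H₂ : Matrix (Fin N) (Fin N) L} (T : GL (Fin N) (mixedSpace L))
  (Φ : UnitaryGroup.arch (↥(maximalRealSubfield L)) L (IsCMField.complexConj L) N H₂ ≃ₜ* UnitaryGroup.arch (↥(maximalRealSubfield L)) L (IsCMField.complexConj L) N H)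
  (hΦ : ∀ g : UnitaryGroup.arch (↥(maximalRealSubfield L)) L (IsCMField.complexConj L) N H₂,
    ((Φ g : UnitaryGroup.arch (↥(maximalRealSubfield L)) L (IsCMField.complexConj L) N H) : GL (Fin N) (mixedSpace L)) = T * (g : GL (Fin N) (mixedSpace L)) * T⁻¹)

include hΦ in
/-- The inverse isomorphism acts by `y ↦ T⁻¹ y T`. [cite: PlatonovRapinchuk1994, §2.3] -/
theorem coe_archCongr_symm_apply (y : UnitaryGroup.arch (↥(maximalRealSubfield L)) L (IsCMField.complexConj L) N H) :
    ((Φ.symm y : UnitaryGroup.arch (↥(maximalRealSubfield L)) L (IsCMField.complexConj L) N H₂) : GL (Fin N) (mixedSpace L)) =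
      T⁻¹ * (y : GL (Fin N) (mixedSpace L)) * T := by
  have h := hΦ (Φ.symm y)
  rw [ContinuousMulEquiv.apply_symm_apply] at h
  rw [h]
  group

include hΦ in
/-- **`ArchSmooth` IS CARRIED BY THE CONGRUENCE**: if `a ∈ C_c^∞(U(H₂)(L ⊗ ℝ))` (restriction of a right-translation-smooth compactly supported `φ` on `GL_N(L ⊗ ℝ)`), then `a ∘ Φ⁻¹ ∈
C_c^∞(U(H)(L ⊗ ℝ))` — it is the restriction of `y ↦ φ(T⁻¹ y T)` (§1). «`f_v = f′_v ∘ ψ_v⁻¹`». [cite: Rogawski1990, §14.2 p. 233; §14.4 p. 237] [cite: BorelJacquet1979, §4.1] -/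
theorem ArchSmooth.comp_archCongr_symm {a : UnitaryGroup.arch (↥(maximalRealSubfield L)) L (IsCMField.complexConj L) N H₂ → ℂ} (ha : ArchSmooth L N H₂ a) :
    ArchSmooth L N H (a ∘ Φ.symm) := by
  obtain ⟨φ, hφc, hφs, hφsm, hφa⟩ := ha
  refine ⟨fun y => φ (T⁻¹ * y * T), hφc.comp_units_conj T, hφs.comp_units_conj T, hφsm.comp_units_conj T, fun k => ?_⟩
  simp only [Function.comp_apply]
  rw [hφa, coe_archCongr_symm_apply L T Φ hΦ k]

include hΦ in
/-- The converse direction along `Φ` itself: `a ∈ C_c^∞(U(H)) ⇒ a ∘ Φ ∈ C_c^∞(U(H₂))` (restriction of `x ↦ φ(T x T⁻¹)`, §1 at `T⁻¹`). [cite: Rogawski1990, §14.2 p. 233] [cite: BorelJacquet1979, §4.1] -/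
theorem ArchSmooth.comp_archCongr {a : UnitaryGroup.arch (↥(maximalRealSubfield L)) L (IsCMField.complexConj L) N H → ℂ} (ha : ArchSmooth L N H a) :
    ArchSmooth L N H₂ (a ∘ Φ) := by
  obtain ⟨φ, hφc, hφs, hφsm, hφa⟩ := ha
  refine ⟨fun y => φ (T⁻¹⁻¹ * y * T⁻¹), hφc.comp_units_conj T⁻¹, hφs.comp_units_conj T⁻¹, hφsm.comp_units_conj T⁻¹, fun k => ?_⟩
  simp only [Function.comp_apply]
  rw [hφa, hΦ k, inv_inv]

include hΦ in
/-- `ArchSmooth L N H (a ∘ Φ⁻¹) ↔ ArchSmooth L N H₂ a`. [cite: Rogawski1990, §14.2 p. 233] [cite: BorelJacquet1979, §4.1] -/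
theorem archSmooth_comp_archCongr_symm_iff (a : UnitaryGroup.arch (↥(maximalRealSubfield L)) L (IsCMField.complexConj L) N H₂ → ℂ) :
    ArchSmooth L N H (a ∘ Φ.symm) ↔ ArchSmooth L N H₂ a := by
  refine ⟨fun h => ?_, fun h => h.comp_archCongr_symm L T Φ hΦ⟩
  have h2 := h.comp_archCongr L T Φ hΦ
  have hcomp : (a ∘ Φ.symm) ∘ Φ = a := funext fun x => by
    show a (Φ.symm (Φ x)) = a x
    rw [ContinuousMulEquiv.symm_apply_apply]
  rw [hcomp] at h2
  exact h2

end Arch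

end Literature.NumberTheory.Rogawski1990

end
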